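import Summits.ResolutionOfSingularities.ResolutionOfSingularities.Theorems.FrobeniusLadderFRationalResolutionStalkIsoNhd
import HarnessLib

/-!
# Isomorphic stalks give isomorphic open neighbourhoods

Support file for crux stmt-ResolutionOfSingularities-15317 (`FrobeniusLadder.FRationalResolution`),
line `Sketch`, continuation seat c3, cycle 10 (closure of theme REC). The two-sided form of
Zariski-local recognition: for integral `k`-schemes `X`, `Y` locally of finite type and a
`k`-compatible isomorphism of stalks `e : 𝒪_{Y,y} ≅ 𝒪_{X,x}`, there are open neighbourhoods
`x ∈ U ⊆ X`, `y ∈ V ⊆ Y` and an isomorphism of schemes `U ≅ V` over `k` taking `x` to `y`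
(`exists_isOpenImmersion_nhd_of_stalk_iso` gives an open immersion `j : U → Y` with `j x = y`;
take `V = j(U)` and `Scheme.Hom.isoOpensRange`). [cite: StacksProject, Tag 0BX6; folklore]
-/

-- single-problem summit: the doubled namespace component is forced
set_option linter.dupNamespace false

noncomputable section

namespace Summit.ResolutionOfSingularities.ResolutionOfSingularities.Theorems.FRationalResolution

open CategoryTheory AlgebraicGeometry TopologicalSpace

/-- **Isomorphic stalks give isomorphic open neighbourhoods.** Let `X`, `Y` be integral schemes
locally of finite type over a field `k`, `x ∈ X`, `y ∈ Y`, and `e : 𝒪_{Y,y} ≅ 𝒪_{X,x}` an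
isomorphism of local rings compatible with the structure maps. Then there are opens `x ∈ U ⊆ X`,
`y ∈ V ⊆ Y` and an isomorphism `g : U ≅ V` over `k` with `g x = y`.
[cite: StacksProject, Tag 0BX6; folklore] -/
theorem exists_opens_iso_of_stalk_iso (k : Type) [Field k] (X Y : Scheme.{0}) [IsIntegral X]
    [IsIntegral Y] (fX : X ⟶ Spec (.of k)) (fY : Y ⟶ Spec (.of k)) [LocallyOfFiniteType fX]
    [LocallyOfFiniteType fY] (x : X) (y : Y) (e : Y.presheaf.stalk y ≅ X.presheaf.stalk x)
    (he : Spec.map e.hom ≫ Y.fromSpecStalk y ≫ fY = X.fromSpecStalk x ≫ fX) :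
    ∃ (U : X.Opens) (V : Y.Opens) (hxU : x ∈ U) (hyV : y ∈ V) (g : (U : Scheme.{0}) ≅ (V : Scheme.{0})),
      g.hom.base ⟨x, hxU⟩ = ⟨y, hyV⟩ ∧ g.hom ≫ V.ι ≫ fY = U.ι ≫ fX := by
  obtain ⟨U, hxU, j, hj, hjx, hjk⟩ :=
    exists_isOpenImmersion_nhd_of_stalk_iso k X Y fX fY x y e he
  haveI := hj
  have hyV : y ∈ j.opensRange := ⟨⟨x, hxU⟩, hjx⟩
  refine ⟨U, j.opensRange, hxU, hyV, j.isoOpensRange, ?_, ?_⟩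
  · apply Subtype.ext
    have h := congrArg (fun t : (U : Scheme.{0}) ⟶ Y => t ⟨x, hxU⟩) j.isoOpensRange_hom_ι
    simp only [Scheme.Hom.comp_apply] at h
    rw [Scheme.Opens.ι_apply] at h
    rw [h]
    exact hjx
  · rw [← Category.assoc, Scheme.Hom.isoOpensRange_hom_ι, hjk]

end Summit.ResolutionOfSingularities.ResolutionOfSingularities.Theorems.FRationalResolution

end
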